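import Summits.HodgeConjecture.HodgeConjecture.Theorems.MarkmanPartnerTransportPicardThreeK3SquaresRMTypeOpenSubtypeOddPicard
import Summits.HodgeConjecture.HodgeConjecture.Theorems.MarkmanPartnerTransportPicardThreeK3SquaresZeta9SubtypeByName
import Summits.HodgeConjecture.HodgeConjecture.Theorems.MarkmanPartnerTransportPicardThreeK3SquaresZeta11SubtypeByName
import HarnessLib

/-!
# Route MarkmanPartnerTransport · crux `PicardThreeK3Squares` (stmt-HodgeConjecture-19652) —
# HC⁴(S ⊗ S) BY NAME for every K3 surface of ODD Picard number on the ζ₉ and ζ₁₁ real-multiplication loci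
# (Picard numbers 13 and 7), from the period alone

Cell hodge-nonav, crux #4 (HC⁴(S ⊗ S), ρ(S) ≥ 3; open core: real multiplication), programme «RATIONAL ORBIT
DENSITY» continued (prover seat hodge-nonav-19652-p1 gen 20; `--supports stmt-HodgeConjecture-19652`,
helper). Consumers of (T⁗-odd) `hodgeConjectureFor_square_of_openAll_of_odd_picard_of_separable`
(`…RMTypeOpenSubtypeOddPicard`: at odd Picard number the period alone suffices) with the ∀-member forms of
the van Geemen–Schütt open-period-set facts (`VanGeemenSchuett2025_zeta9_cycleOnOpenPeriodSet_everyMember`,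
`VanGeemenSchuett2025_OguisoZhang2011_zeta11_cycleOnOpenPeriodSet_everyMember`). CONDITIONAL on those two
facts, `Buskin2019_hodgeIsometry_algebraic` and `Huybrechts_K3_marking_exists`; credits nothing; nothing here
says HC is proved; rung F-H1 not moved.

* `isRoot_map_of_eigen` — if `θ_ℂ·P(θ_ℂ) = 0`, `θ_ℂ y = e·y`, `y ≠ 0`, `e ≠ 0` then `P(e) = 0`;
  `ratCast_ne_of_isRoot_of_forall_not_isRoot` — a complex root of a rational polynomial without rational
  roots is irrational.
* **`exists_zeta9Locus_hodgeConjectureFor_square_of_odd_picard`** — THERE IS a ζ₉ datum `(g, y₀, θ)` such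
  that EVERY marked projective K3 surface `(S, η, p, x)` of ODD Picard number whose period is carried by a
  rational isometry `σ` of `Λ_ℚ` onto the ζ₉ Hodge locus (`θ_ℂ(σx) = 2cos(2π/9)·σx`) satisfies
  `HodgeConjectureFor 4 (S ⊗ S)`. No endomorphism, polynomial, generation or conjugation hypothesis on `S`.
  These are exactly the ODD-Picard points of the ζ₉ locus, all of Picard number `13` (`T(S)_ℚ` an
  `F`-subspace of `F`-rank `3` of the model's rank-`4` space, `F = ℚ(ζ₉ + ζ₉⁻¹)`; the cell's rung
  «RungRank13»), i.e. (Witt over `ℚ`, not formalised) the `ρ = 13` K3 surfaces with RM by `F` whose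
  `F`-ternary form is represented by the ζ₉ model form.
* **`hodgeConjectureFor_square_of_zeta11Locus_of_odd_picard`** — for every ζ₁₁ datum `(g, u₁, u₂, y₀, θ)`,
  EVERY marked projective K3 surface of ODD Picard number whose period is carried by a rational isometry
  onto the ζ₁₁ Hodge locus (`θ_ℂ(σx) = 2cos(2π/11)·σx`) satisfies `HodgeConjectureFor 4 (S ⊗ S)` — the
  Picard-number-`7` points of the ζ₁₁ locus (terminal type `(7,5,3)` of the cell's Noether–Lefschetz
  ascent), i.e. the `ρ = 7` K3 surfaces with RM by `ℚ(ζ₁₁ + ζ₁₁⁻¹)` whose `F`-ternary form is represented by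
  the ζ₁₁ model's `U^⊥ ⊗ ℚ`.

No definition, no sorry, no new named fact. References: van Geemen–Schütt, Forum Math. Sigma 13 (2025) e2,
Thm. 1.1 (9), (11), §3.4, §4.8, §5.6, §5.8, §6.6; Oguiso–Zhang, Pure Appl. Math. Q. 7 (2011), Thm. 1.5;
Buskin, J. reine angew. Math. 755 (2019), Thm. 1.1; van Geemen, Michigan Math. J. 56 (2008) Lemma 3.2;
Huybrechts, *Lectures on K3 Surfaces*, Ch. 3 Cor. 3.6, Ch. 6 Prop. 1.5.
-/

set_option linter.dupNamespace false

noncomputable section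

namespace Summit.HodgeConjecture.HodgeConjecture.Theorems.MarkmanPartnerTransport.RMTypeOrbit

open CategoryTheory MonoidalCategory Polynomial
open Literature.AlgebraicGeometry Literature.AlgebraicGeometry.Motives Literature.AlgebraicGeometry.HodgeTheory
open Literature.AlgebraicGeometry.Surfaces Literature.LinearAlgebra.QuadraticForm
open Literature.AlgebraicTopology.SingularHomology
open Summit.HodgeConjecture.HodgeConjecture.Theorems.NikulinTwinTransport
open Summit.HodgeConjecture.HodgeConjecture.Theorems.MarkmanPartnerTransport.IsogenyInvariance
open Summit.HodgeConjecture.HodgeConjecture.Theorems.MarkmanPartnerTransport.RMTypeDescent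

/-- `MarkedK3[S, η, p, x]`: VERBATIM the `let MarkedK3 := …` binder of the route declaration
`PicardThreeK3Squares` (as in `…RMTypeDescent`). Local notation only. -/
local notation3 (prettyPrint := false) "MarkedK3[" S ", " η ", " p ", " x "]" =>
  (p ≠ 0 ∧ (IsIntegralClass p ∧
    (∀ q : complexBetti S (2 * 2), IsIntegralClass q → ∃ n : ℤ, q = n • p) ∧
    (∀ c : complexBetti S (2 * 1), IsIntegralClass c ↔ ∃ v : K3Index → ℤ, η c = fun i => (v i : ℂ)) ∧
    (∀ a b : complexBetti S (2 * 1),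
      cupProduct (rfl : 2 * 1 + 2 * 1 = 2 * 2) a b = k3Form (η a) (η b) • p) ∧
    IsOfHodgeType 2 S (2 * 1) 2 0 (LinearEquiv.symm η x) ∧
    (∀ τ : complexBetti S (2 * 1), IsOfHodgeType 2 S (2 * 1) 2 0 τ →
      ∃ t : ℂ, τ = t • LinearEquiv.symm η x)) ∧
    (k3Form x x = 0 ∧ 0 < (k3Form (star x) x).re ∧
      ∃ u : K3Index → ℤ, k3Form (fun i => (u i : ℂ)) x = 0 ∧ 0 < ∑ i, ∑ j, u i * k3Gram i j * u j))

variable {S : SchemeOver ℂ}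

/-- `CycleAll[θ, e, U]`: the STRONG ∃-form open-set input — at EVERY period point of `D_{θ,e}` in `U`
(`θ`-generic OR NOT) there is a marked projective K3 surface carrying an algebraic class inducing
`η'⁻¹ θ_ℂ η'`. (`CycleEx[θ, e, U]` of `…RMTypeOpenExists` is the same clause restricted to `θ`-generic
periods.) Local notation only. -/
local notation3 (prettyPrint := false) "CycleAll[" θ ", " e ", " U "]" =>
  (∀ y : K3Index → ℂ, y ∈ U → thetaC θ y = (e : ℂ) • y → k3Form y y = 0 → 0 < (k3Form (star y) y).re →
    ∃ (S' : SchemeOver ℂ) (hS' : IsK3Surface S') (η' : complexBetti S' (2 * 1) ≃ₗ[ℂ] (K3Index → ℂ))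
      (p' : complexBetti S' (2 * 2)), MarkedK3[S', η', p', y] ∧
      ∃ γ' ∈ algebraicClasses (S' ⊗ S') 2, ∀ z : complexBetti S' (2 * 1),
        (η'.symm.toLinearMap ∘ₗ (thetaC θ ∘ₗ η'.toLinearMap)) z =
          complexGysin complexOrientationFamily
            (IsSmoothProjective.tensor_holds hS'.isSmoothProjective hS'.isSmoothProjective)
            hS'.isSmoothProjective (SemiCartesianMonoidalCategory.fst S' S')
            (rfl : 2 * 1 + 2 * 2 + 2 * 2 = 2 * 1 + 2 * (2 + 2))
            (cupProduct (rfl : 2 * 1 + 2 * 2 = 2 * 1 + 2 * 2)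
              (complexBetti.map (SemiCartesianMonoidalCategory.snd S' S') (2 * 1) z) γ'))

/-- `OpenAll[θ, e]`: there is an open `U ⊂ Λ_ℂ` containing a `θ`-GENERIC period point of `D_{θ,e}` on
which `CycleAll[θ, e, U]` holds. Local notation only. -/
local notation3 (prettyPrint := false) "OpenAll[" θ ", " e "]" =>
  (∃ U : Set (K3Index → ℂ), IsOpen U ∧
    (∃ y₁ ∈ U, thetaC θ y₁ = (e : ℂ) • y₁ ∧ k3Form y₁ y₁ = 0 ∧ 0 < (k3Form (star y₁) y₁).re ∧
      ∀ v : K3Index → ℚ, k3Form (fun i => (v i : ℂ)) y₁ = 0 → Matrix.mulVec θ v = 0) ∧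
    CycleAll[θ, e, U])

/-- `Zeta9Model[g, y₀, θ]`: VERBATIM the datum conjuncts of the named fact
`VanGeemenSchuett2025_zeta9_cycleOnOpenPeriodSet` (as in `…Zeta9Type`). Local notation only. -/
local notation3 (prettyPrint := false) "Zeta9Model[" g ", " y₀ ", " θ "]" =>
  ((∀ a b : K3Index → ℂ, k3Form (g a) (g b) = k3Form a b) ∧
    (∀ v : K3Index → ℤ, ∃ w : K3Index → ℤ,
      g (fun i => ((v i : ℤ) : ℂ)) = fun i => ((w i : ℤ) : ℂ)) ∧
    g ^ 9 = 1 ∧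
    Module.finrank ℂ (LinearMap.ker (g ^ 3 - 1)) = 10 ∧
    k3Form y₀ y₀ = 0 ∧ 0 < (k3Form (star y₀) y₀).re ∧
    g y₀ = Complex.exp (2 * Real.pi * Complex.I / 9) • y₀ ∧
    (∀ y : K3Index → ℂ, thetaC θ y =
      (1 / 3 : ℂ) • ((2 : ℂ) • g y + (2 : ℂ) • (g ^ 8) y - (g ^ 2) y - (g ^ 4) y - (g ^ 5) y
        - (g ^ 7) y)))

/-- The cubic `X³ - 3X + 1 ∈ ℚ[X]` (minimal polynomial of `2cos(2π/9)`). Local notation only. -/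
local notation3 (prettyPrint := false) "P₉" => (X ^ 3 - C (3 : ℚ) * X + 1 : ℚ[X])

/-- `Zeta11Model[g, u₁, u₂, y₀, θ]`: VERBATIM the antecedents of the named fact
`VanGeemenSchuett2025_OguisoZhang2011_zeta11_cycleOnOpenPeriodSet` (as in `…PicardThreeK3SquaresZeta11Type`).
Local notation only. -/
local notation3 (prettyPrint := false) "Zeta11Model[" g ", " u₁ ", " u₂ ", " y₀ ", " θ "]" =>
  ((∀ a b : K3Index → ℂ, k3Form (g a) (g b) = k3Form a b) ∧
    (∀ v : K3Index → ℤ, ∃ w : K3Index → ℤ,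
      g (fun i => ((v i : ℤ) : ℂ)) = fun i => ((w i : ℤ) : ℂ)) ∧
    g ^ 11 = 1 ∧
    g (fun i => ((u₁ i : ℤ) : ℂ)) = (fun i => ((u₁ i : ℤ) : ℂ)) ∧
    g (fun i => ((u₂ i : ℤ) : ℂ)) = (fun i => ((u₂ i : ℤ) : ℂ)) ∧
    k3Form (fun i => ((u₁ i : ℤ) : ℂ)) (fun i => ((u₁ i : ℤ) : ℂ)) = 0 ∧
    k3Form (fun i => ((u₂ i : ℤ) : ℂ)) (fun i => ((u₂ i : ℤ) : ℂ)) = 0 ∧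
    k3Form (fun i => ((u₁ i : ℤ) : ℂ)) (fun i => ((u₂ i : ℤ) : ℂ)) = 1 ∧
    (∀ v : K3Index → ℤ, g (fun i => ((v i : ℤ) : ℂ)) = (fun i => ((v i : ℤ) : ℂ)) →
      ∃ m n : ℤ, v = m • u₁ + n • u₂) ∧
    k3Form y₀ y₀ = 0 ∧ 0 < (k3Form (star y₀) y₀).re ∧
    g y₀ = Complex.exp (2 * Real.pi * Complex.I / 11) • y₀ ∧
    (∀ y : K3Index → ℂ, thetaC θ y =
      g y + (g ^ 10) y - (2 * k3Form y (fun i => ((u₂ i : ℤ) : ℂ))) • (fun i => ((u₁ i : ℤ) : ℂ))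
        - (2 * k3Form y (fun i => ((u₁ i : ℤ) : ℂ))) • (fun i => ((u₂ i : ℤ) : ℂ))))

/-- `πU[u₁, u₂]`: the `k3Form`-orthogonal projector `y ↦ (y.u₂)u₁ + (y.u₁)u₂` onto the hyperbolic plane
`ℂu₁ ⊕ ℂu₂` (for `(u₁.u₁) = (u₂.u₂) = 0`, `(u₁.u₂) = 1`). Local notation only. -/
local notation3 (prettyPrint := false) "πU[" u₁ ", " u₂ "]" =>
  ((LinearMap.smulRight (k3FormC (fun i : K3Index => ((u₂ i : ℤ) : ℂ))) (fun i : K3Index => ((u₁ i : ℤ) : ℂ)) +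
      LinearMap.smulRight (k3FormC (fun i : K3Index => ((u₁ i : ℤ) : ℂ))) (fun i : K3Index => ((u₂ i : ℤ) : ℂ)) :
    Module.End ℂ (K3Index → ℂ)))

/-- `Q₁₁ = (X - 2)(X⁵ + X⁴ - 4X³ - 3X² + 3X + 1) ∈ ℚ[X]`: `X - 2` times the minimal polynomial of `ζ₁₁ + ζ₁₁⁻¹`.
Local notation only. -/
local notation3 (prettyPrint := false) "Q₁₁" =>
  ((X - C (2 : ℚ)) * (X ^ 5 + X ^ 4 - C (4 : ℚ) * X ^ 3 - C (3 : ℚ) * X ^ 2 + C (3 : ℚ) * X + 1) : ℚ[X])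

/-- The quintic `P₁₁ = X⁵ + X⁴ - 4X³ - 3X² + 3X + 1 ∈ ℚ[X]` (minimal polynomial of `2cos(2π/11)`).
Local notation only. -/
local notation3 (prettyPrint := false) "P₁₁" =>
  (X ^ 5 + X ^ 4 - C (4 : ℚ) * X ^ 3 - C (3 : ℚ) * X ^ 2 + C (3 : ℚ) * X + 1 : ℚ[X])

/-- `OddLocusHC[θ, e]`: **HC⁴(S ⊗ S) for every marked projective K3 surface of ODD Picard number whose
period is carried by a rational isometry of `Λ_ℚ` onto the Hodge locus `D_{θ,e}`.** Local notation only. -/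
local notation3 (prettyPrint := false) "OddLocusHC[" θ ", " e "]" =>
  (∀ (S : SchemeOver ℂ) (hS : IsK3Surface S) (_hodd : Odd (Module.finrank ℂ ↥(algebraicClasses S 1)))
    (η : complexBetti S (2 * 1) ≃ₗ[ℂ] (K3Index → ℂ)) (p : complexBetti S (2 * 2)) (x : K3Index → ℂ)
    (_hM : MarkedK3[S, η, p, x])
    (σ : Module.End ℂ (K3Index → ℂ)) (_hσ : ∀ a b, k3Form (σ a) (σ b) = k3Form a b)
    (_hσrat : ∀ v : K3Index → ℤ, ∃ w : K3Index → ℚ, σ (fun i => (v i : ℂ)) = fun i => (w i : ℂ))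
    (_heig : thetaC θ (σ x) = ((e : ℝ) : ℂ) • σ x),
    HodgeConjectureFor 4 (S ⊗ S))

/-! ### Two algebraic trivialities -/

/-- If `θ_ℂ·P(θ_ℂ) = 0` on `Λ_ℂ` and `y ≠ 0` is a `θ_ℂ`-eigenvector with eigenvalue `e ≠ 0`, then `P(e) = 0`.
[folklore] -/
theorem isRoot_map_of_eigen {θ : Matrix K3Index K3Index ℚ} {P : ℚ[X]}
    (hθP : aeval (thetaC θ) (X * P.map (algebraMap ℚ ℂ)) = 0) {e : ℂ} (he : e ≠ 0)
    {y : K3Index → ℂ} (hy0 : y ≠ 0) (hy : thetaC θ y = e • y) : (P.map (algebraMap ℚ ℂ)).IsRoot e := by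
  have h1 := LinearMap.congr_fun hθP y
  rw [LinearMap.zero_apply, aeval_apply_of_eigen hy, smul_eq_zero, Polynomial.eval_mul, Polynomial.eval_X,
    mul_eq_zero] at h1
  rcases h1 with (h1 | h1) | h1
  · exact absurd h1 he
  · exact h1
  · exact absurd h1 hy0

/-- A complex root of a rational polynomial without rational roots is not rational. [folklore] -/
theorem ratCast_ne_of_isRoot_of_forall_not_isRoot {P : ℚ[X]} (hno : ∀ a : ℚ, ¬ P.IsRoot a) {e : ℂ}
    (he : (P.map (algebraMap ℚ ℂ)).IsRoot e) (a : ℚ) : (a : ℂ) ≠ e := by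
  intro ha
  apply hno a
  have h1 : Polynomial.aeval (algebraMap ℚ ℂ a) P = 0 := by
    rw [eq_ratCast, ha, ← Polynomial.eval_map_algebraMap]
    exact he
  rw [Polynomial.aeval_algebraMap_apply_eq_algebraMap_eval, map_eq_zero_iff _ (algebraMap ℚ ℂ).injective] at h1
  exact h1

/-! ### The ζ₉ locus at odd Picard number (`ρ = 13`) -/

/-- **HC⁴(S ⊗ S) for every K3 surface of ODD Picard number on the ζ₉ real-multiplication locus** (these
have `ρ(S) = 13`: the cell's rung «RungRank13», cubic RM by `ℚ(ζ₉ + ζ₉⁻¹)`). THERE IS a ζ₉ datum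
`(g, y₀, θ)` (as in `exists_zeta9Type_hodgeConjectureFor_square`) such that EVERY projective K3 surface `S`
of odd Picard number, marked by `(η, p, x)`, whose period is carried by a rational isometry `σ` of `Λ_ℚ` onto
the Hodge locus of `θ` (`θ_ℂ(σx) = 2cos(2π/9)·σx`) satisfies `HodgeConjectureFor 4 (S ⊗ S)`. Proof: the
∀-member fact supplies the datum and `OpenAll[θ, e₀]`; `θ` is self-adjoint (`selfAdjoint_of_zeta9Model`),
`θ(θ³ - 3θ + 1) = 0` (`aeval_X_mul_cubic_eq_zero_of_zeta9Model`), `X³ - 3X + 1` is separable without rational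
roots, so the eigenvalue is irrational (`isRoot_map_of_eigen`, `ratCast_ne_of_isRoot_of_forall_not_isRoot`);
(T⁗-odd) `hodgeConjectureFor_square_of_openAll_of_odd_picard_of_separable` concludes. Which surfaces (Witt
over `ℚ`, not formalised): the `ρ = 13` K3 surfaces with real multiplication by `F = ℚ(ζ₉ + ζ₉⁻¹)` whose
`F`-ternary form `(T(S)_ℚ, Φ_S)` is represented by the ζ₉ model's `F`-quaternary form — a CONDITION
(Hasse–Minkowski over `F`), met by some and not by all. CONDITIONAL on `Buskin2019_hodgeIsometry_algebraic`,
`Huybrechts_K3_marking_exists` and `VanGeemenSchuett2025_zeta9_cycleOnOpenPeriodSet_everyMember` ONLY;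
credits nothing; HC is NOT proved here. [cite: GeemenSchutt2023, Thm. 1.1 (9), §3.4, §4.8, §5.6 and §6.6]
[cite: ArtebaniComparinValdes2020Order9, Example 3.5] [cite: Buskin2019, Thm. 1.1]
[cite: VanGeemen2008RM, Lemma 3.2] [cite: Omeara1963, 63:21 and 66:3] -/
theorem exists_zeta9Locus_hodgeConjectureFor_square_of_odd_picard
    (hB : Buskin2019_hodgeIsometry_algebraic) (hmark : Huybrechts_K3_marking_exists)
    (hV : VanGeemenSchuett2025_zeta9_cycleOnOpenPeriodSet_everyMember) :
    ∃ (g : Module.End ℂ (K3Index → ℂ)) (y₀ : K3Index → ℂ) (θ : Matrix K3Index K3Index ℚ),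
      Zeta9Model[g, y₀, θ] ∧ OddLocusHC[θ, (2 * Real.cos (2 * Real.pi / 9) : ℝ)] := by
  obtain ⟨g, y₀, θ, hg, hgint, hg9, hfin, hy₀₀, hy₀p, hgy₀, hθ, U, hU, ⟨y₁, hy₁U, hy₁, h₁₁, h₁p, hy₁gen⟩,
    hcyc⟩ := hV
  have hZ : Zeta9Model[g, y₀, θ] := ⟨hg, hgint, hg9, hfin, hy₀₀, hy₀p, hgy₀, hθ⟩
  refine ⟨g, y₀, θ, hZ, ?_⟩
  intro S hS hodd η p x hM σ hσ hσrat heig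
  have hθsa : ∀ a b : K3Index → ℂ, k3Form (thetaC θ a) b = k3Form a (thetaC θ b) :=
    selfAdjoint_of_zeta9Model hg hg9 hθ
  have hθP := aeval_X_mul_cubic_eq_zero_of_zeta9Model hZ
  have he₀ : (((2 * Real.cos (2 * Real.pi / 9) : ℝ)) : ℂ) ≠ 0 := by
    exact_mod_cast two_mul_cos_two_pi_div_nine_pos.ne'
  have hσx0 : σ x ≠ 0 := ne_zero_of_star_self_re_pos (periodPt_ratIsometry σ hσ hσrat hM.2.2).2.1
  have hroot := isRoot_map_of_eigen hθP he₀ hσx0 heig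
  have hirr : ∀ a : ℚ, (a : ℂ) ≠ (((2 * Real.cos (2 * Real.pi / 9) : ℝ)) : ℂ) :=
    ratCast_ne_of_isRoot_of_forall_not_isRoot not_isRoot_cubic hroot
  exact hodgeConjectureFor_square_of_openAll_of_odd_picard_of_separable hB hmark hθsa hirr cubic_separable hθP
    ⟨U, hU, ⟨y₁, hy₁U, hy₁, h₁₁, h₁p, hy₁gen⟩, fun y hyU hy hyy hyp =>
      let ⟨S', hS', η', p', hM', hγ'⟩ := hcyc y hyU hy hyy hyp
      ⟨S', hS', η', p', hM', hγ'⟩⟩ hS hodd η p x hM σ hσ hσrat heig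

/-! ### The ζ₁₁ locus at odd Picard number (`ρ = 7`) -/

/-- `2cos(2π/11) ≠ 2` (`cos(2π/11) < 1`). [folklore] -/
theorem two_mul_cos_two_pi_div_eleven_ne_two : (((2 * Real.cos (2 * Real.pi / 11) : ℝ)) : ℂ) ≠ 2 := by
  have hlt : Real.cos (2 * Real.pi / 11) < Real.cos 0 := by
    apply Real.cos_lt_cos_of_nonneg_of_le_pi (le_refl 0)
    · nlinarith [Real.pi_pos]
    · nlinarith [Real.pi_pos]
  rw [Real.cos_zero] at hlt
  have hne : (2 * Real.cos (2 * Real.pi / 11) : ℝ) ≠ 2 := by nlinarith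
  exact_mod_cast hne

/-- The quintic `P₁₁` has no rational root (it is irreducible of degree `5`:
`CyclicQuintic11.quinticPolyRat_irreducible`). [folklore] -/
theorem not_isRoot_quintic (a : ℚ) : ¬ (P₁₁).IsRoot a := by
  intro ha
  rw [quintic_eq_quinticPolyRat] at ha
  have h1 := Polynomial.degree_eq_one_of_irreducible_of_root
    Literature.NumberTheory.NumberFields.CyclicQuintic11.quinticPolyRat_irreducible ha
  rw [Polynomial.degree_eq_natDegree Literature.NumberTheory.NumberFields.CyclicQuintic11.quinticPolyRat_ne_zero,
    Literature.NumberTheory.NumberFields.CyclicQuintic11.quinticPolyRat_natDegree] at h1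
  exact absurd h1 (by decide)

/-- **HC⁴(S ⊗ S) for every K3 surface of ODD Picard number on the ζ₁₁ real-multiplication locus** (these
have `ρ(S) = 7`: the terminal type `(7,5,3)` of the cell's Noether–Lefschetz ascent, quintic RM by
`ℚ(ζ₁₁ + ζ₁₁⁻¹)`, INSIDE the crux's Picard list). For every ζ₁₁ datum `(g, u₁, u₂, y₀, θ)` (as in
`hodgeConjectureFor_square_of_zeta11Type`), EVERY projective K3 surface `S` of odd Picard number, marked by
`(η, p, x)`, whose period is carried by a rational isometry `σ` of `Λ_ℚ` onto the Hodge locus of `θ`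
(`θ_ℂ(σx) = 2cos(2π/11)·σx`) satisfies `HodgeConjectureFor 4 (S ⊗ S)`. Proof: the ∀-member fact supplies
`OpenAll[θ, e₀]`; `θ` is self-adjoint, `θ·Q₁₁(θ) = 0` with `Q₁₁ = (X - 2)·P₁₁` separable; the eigenvalue is
a root of `Q₁₁`, not `2`, hence of the irreducible quintic `P₁₁`, hence irrational; (T⁗-odd) concludes. Which
surfaces (Witt over `ℚ`, not formalised): the `ρ = 7` K3 surfaces with real multiplication by
`F = ℚ(ζ₁₁ + ζ₁₁⁻¹)` whose `F`-ternary form is represented by the ζ₁₁ model's `F`-quaternary form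
`U^⊥ ⊗ ℚ` — a CONDITION, met by some and not by all. CONDITIONAL on `Buskin2019_hodgeIsometry_algebraic`,
`Huybrechts_K3_marking_exists` and `VanGeemenSchuett2025_OguisoZhang2011_zeta11_cycleOnOpenPeriodSet_everyMember`
ONLY; credits nothing; HC is NOT proved here. [cite: GeemenSchutt2023, Thm. 1.1 (11), §3.4, §4.8, §5.8 and §6.6]
[cite: OguisoZhang2011K3Order11, Thm. 1.5 (3)] [cite: Buskin2019, Thm. 1.1] [cite: VanGeemen2008RM, Lemma 3.2]
[cite: Omeara1963, 63:21 and 66:3] -/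
theorem hodgeConjectureFor_square_of_zeta11Locus_of_odd_picard
    (hB : Buskin2019_hodgeIsometry_algebraic) (hmark : Huybrechts_K3_marking_exists)
    (hV : VanGeemenSchuett2025_OguisoZhang2011_zeta11_cycleOnOpenPeriodSet_everyMember)
    {g : Module.End ℂ (K3Index → ℂ)} {u₁ u₂ : K3Index → ℤ} {y₀ : K3Index → ℂ} {θ : Matrix K3Index K3Index ℚ}
    (hZ : Zeta11Model[g, u₁, u₂, y₀, θ]) : OddLocusHC[θ, (2 * Real.cos (2 * Real.pi / 11) : ℝ)] := by
  intro S hS hodd η p x hM σ hσ hσrat heig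
  have hθP := aeval_X_mul_sextic_eq_zero_of_zeta11Model hZ
  have hθsa := thetaC_selfAdjoint_of_zeta11Model hZ
  obtain ⟨hg, hgint, hg11, hgu₁, hgu₂, hu₁, hu₂, hu₁₂, hfix, hy₀₀, hy₀p, hgy₀, hθ⟩ := hZ
  obtain ⟨U, hU, ⟨y₁, hy₁U, hy₁, h₁₁, h₁p, hy₁gen⟩, hcyc⟩ :=
    hV g u₁ u₂ y₀ θ hg hgint hg11 hgu₁ hgu₂ hu₁ hu₂ hu₁₂ hfix hy₀₀ hy₀p hgy₀ hθ
  have he₀ : (((2 * Real.cos (2 * Real.pi / 11) : ℝ)) : ℂ) ≠ 0 := by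
    exact_mod_cast two_mul_cos_two_pi_div_eleven_pos.ne'
  have hσx0 : σ x ≠ 0 := ne_zero_of_star_self_re_pos (periodPt_ratIsometry σ hσ hσrat hM.2.2).2.1
  have hrootQ := isRoot_map_of_eigen hθP he₀ hσx0 heig
  -- a root of `Q₁₁ = (X - 2)·P₁₁` other than `2` is a root of `P₁₁`
  have hrootP : ((P₁₁).map (algebraMap ℚ ℂ)).IsRoot (((2 * Real.cos (2 * Real.pi / 11) : ℝ)) : ℂ) := by
    rw [Polynomial.IsRoot.def, Polynomial.map_mul, Polynomial.eval_mul, mul_eq_zero] at hrootQ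
    rcases hrootQ with h | h
    · rw [Polynomial.map_sub, Polynomial.map_X, Polynomial.map_C, Polynomial.eval_sub, Polynomial.eval_X,
        Polynomial.eval_C, sub_eq_zero] at h
      exact absurd (by simpa using h) two_mul_cos_two_pi_div_eleven_ne_two
    · exact h
  have hirr : ∀ a : ℚ, (a : ℂ) ≠ (((2 * Real.cos (2 * Real.pi / 11) : ℝ)) : ℂ) :=
    ratCast_ne_of_isRoot_of_forall_not_isRoot not_isRoot_quintic hrootP
  exact hodgeConjectureFor_square_of_openAll_of_odd_picard_of_separable hB hmark hθsa hirr sextic_separable hθP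
    ⟨U, hU, ⟨y₁, hy₁U, hy₁, h₁₁, h₁p, hy₁gen⟩, fun y hyU hy hyy hyp =>
      let ⟨S', hS', η', p', hM', hγ'⟩ := hcyc y hyU hy hyy hyp
      ⟨S', hS', η', p', hM', hγ'⟩⟩ hS hodd η p x hM σ hσ hσrat heig

end Summit.HodgeConjecture.HodgeConjecture.Theorems.MarkmanPartnerTransport.RMTypeOrbit

end
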